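import Summits.QuantumFields.BalabanUV.T4Continuum.Support.ShellMeasureRootCompositionLevelZero

/-!
# `T4Continuum.ShellMeasureRootCompositionNoFinite` — END-II WITHOUT THE FINITENESS PROVISO: E2′'s per-section
# finiteness binder `hfin` is NOT a hypothesis of the realized (M1) — a section of INFINITE mass satisfies (M1)
# trivially, so the binder can be dropped for every slot with at least one chart coordinate (`0 < n`)
(cell `pub-balaban`, sub-cell `t4`, spine estimate NE7c (node U5b); NE7c formalisation swarm, crew seat
`b2b-balaban-t4-ne7c-formalise-leaf-02` gen 5 — idle-seat offer after file (G) `ShellMeasureLandauHolonomyPrint`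
(p216023), where `hfin` was DISCHARGED on the S22 road by bounding the defined weight; this file REMOVES it at E2′'s
level for EVERY road; imports E2′ `ShellMeasureRootCompositionLevelZero` (p208890, leaf-09) ONLY; [folklore]; 0 `def`,
0 `def … : Prop`, 0 sorry, 0 citations)

HONEST FRAMING.  Finite four-torus programme, rung (B)+1 only — NOT infinite volume, NOT a mass gap, NOT the Clay
problem, NOT summit progress; (B), `BetaPertHyp`, (B^μ) not consumed.  NE7c (`T4IndicatorShell.ShellWeightBound`) is
NOT PRINTED and NOT PROVED; «NE7c ⇐ the named binders»; (M1) realized ≠ NE7c (c3).  Nothing printed is asserted; a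
LOGICAL remark on OUR composition E2′, of the T-NE7c-4 kind (a binder weaker than it looks), nothing about Bałaban's
measures (whose block sections are of course finite).

THE POINT.  (M1) `T4ShellMeasure.SlotAntiConcentration μ u θ ρ D` READS `μ {θ(1−ρ) ≤ u < θ} ≤ ofReal (D·ρ) · μ univ`.
If `μ univ = ∞` it holds for free as soon as `0 < D·ρ` (right side `= ∞`), and for `ρ = 0` the shell
`{θ ≤ u < θ}` is EMPTY — §1 `slotAntiConcentration_of_measure_univ_eq_top`.  E2′
(`ShellMeasureRootCompositionLevelZero.slotAC_realized_su2_of_levelData_cube`) proves the realized (M1) SECTION BY SECTION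
on the chart (`ShellMeasureRootCompositionSU2.slotAC_realized_su2_of_chartAC_gauge`), and its binder
`hfin : ∀ V, ((blockLaw Λ).withDensity (F ∘ section_V)) univ ≠ ∞` serves only the one-depth assembly A3 on the FINITE
sections.  Splitting each exterior section `V` into the two cases — finite: E2′'s own chart-level argument verbatim
(A3 `ShellMeasureLevelAssembly.slotAntiConcentration_of_levelData`, `ShellMeasureScalingSU2.chartLaw_univ_eq`, E2′'s
`slotAntiConcentration_congr_offNull`); infinite: §1, the chart law having the section's mass (`chartLaw_univ_eq`) and
E2′'s constant `D = 2(n + β Σ_p L̄_p(d̄_p + 4s̄_p) + B_𝓔)/(1−δ)` being POSITIVE once `0 < n` — gives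
* §2 **`slotAC_realized_su2_of_levelData_cube_nofin`** = E2′ with the binder `hfin` GONE and `hn : 0 < n` ADDED (every
  block with a chart bond has `n = 3·#Λ ≥ 3`); every other binder and the conclusion VERBATIM.
CONSEQUENCE FOR THE LEDGER (census, not a re-export): the per-section finiteness proviso displayed by E2′ and inherited
by its consumers (S4 f3, S13's seam and tower — `hfin`/`hFfin` families —, S15, S16 f2, S20, the FC, LD and (G) ENDs) is
REMOVABLE in the same way wherever the proof is per section; those files are NOT re-exported here (each consumer may
re-derive over §2 at its next touch; nothing false or weaker is left standing meanwhile — `hfin` is merely idle).  The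
same two-case split applies verbatim to the `SU(N)` END-II (`ShellMeasureRootCompositionSUN`, leaf-08-g7) once landed.
NOT an estimate; NOTHING in the countdown moves; NE7c NOT PROVED; spine PROVED 0/9.  HONEST DEPENDENCY (cell):
continuum YM on T⁴ ⇐ BetaPertH ∧ nine spine estimates (0/9 proved); BetaPertH ⇐ (D1) ∧ (D4) ∧ CAP+tail; G-an2-4 gates
asym, D1 and NE2/3/4.
-/

noncomputable section

open NormedSpace Set Function MeasureTheory Metric

namespace Summit.QuantumFields.BalabanUV.T4Continuum.ShellMeasureRootCompositionNoFinite

open scoped ENNReal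
open Literature.MathematicalPhysics.QuantumFieldTheory.Balaban1983to89
open GaugeField (GaugeInvariant)
open T4ShellMeasure (SlotAntiConcentration)
open T4CubePoincare (cube measurableSet_cube')
open T4CubeChartGnomonic (SU2)
open T4CubeChartExp (expJac expWindowDensity expFibreChart)
open T4ShellMeasureDet (blockLaw)
open T4TreeGaugeFixing (NoClosedLoop fixTo)
open ShellMeasureScalingSU2 (chartLaw_univ_eq mem_cube_of_chartWeight_ne_zero chartWeight_le_smul)
open ShellMeasureWilsonTrace (TraceData)
open ShellMeasureWilsonMoving (MLetter mwordEval mdFro sSum lSum)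
open ShellMeasureLevelAssembly (classifier weight slotAntiConcentration_of_levelData)
open ShellMeasureRootCompositionSU2 (slotAC_realized_su2_of_chartAC_gauge)
open ShellMeasureRootCompositionLevelZero (slotAntiConcentration_congr_offNull)

/-! ## §1 (M1) is free on a measure of infinite mass -/

/-- **(M1) FOR A MEASURE OF INFINITE MASS.**  `SlotAntiConcentration μ u θ ρ D` reads
`μ {θ(1−ρ) ≤ u < θ} ≤ ofReal (D ρ) · μ univ`; with `μ univ = ∞`, `0 ≤ ρ`, `0 < D` it holds: for `ρ = 0` the shell
`{θ ≤ u < θ}` is empty, for `ρ > 0` the right side is `∞`. [folklore] -/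
theorem slotAntiConcentration_of_measure_univ_eq_top {Ω : Type*} [MeasurableSpace Ω] {μ : Measure Ω} (u : Ω → ℝ)
    {θ ρ D : ℝ} (hρ0 : 0 ≤ ρ) (hD : 0 < D) (hμ : μ univ = ∞) : SlotAntiConcentration μ u θ ρ D := by
  unfold SlotAntiConcentration
  rcases hρ0.eq_or_lt with hρ | hρ
  · have hempty : {x | θ * (1 - ρ) ≤ u x ∧ u x < θ} = ∅ := by
      ext x
      simp only [mem_setOf_eq, mem_empty_iff_false, iff_false, not_and, not_lt, ← hρ, sub_zero, mul_one]
      exact fun h => h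
    rw [hempty, measure_empty]
    exact bot_le
  · rw [hμ, ENNReal.mul_top (ENNReal.ofReal_pos.2 (mul_pos hD hρ)).ne']
    exact le_top

/-! ## §2 E2′ without `hfin` -/

section EndTwoNoFin

variable {P : Params} {j : ℕ} [DecidableEq (PBond P j)]
variable {A : Type*} [NormedRing A] [NormedAlgebra ℂ A] [CompleteSpace A] [NormOneClass A]

/-- **END-II, DICTIONARY ON THE CHART CUBE, NO FINITENESS PROVISO — REALIZED (M1) ⇐ SM-L1…L6 + DICTIONARY, PER SLOT
(`G = SU(2)`).**  `ShellMeasureRootCompositionLevelZero.slotAC_realized_su2_of_levelData_cube` (E2′) WORD FOR WORD —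
data `T`, `U₀`, `Λ`, `e`, `S`, `c`, `R`, `F` with the window factorisation `hFw`, `u`; level data `Ttr`, `hol`, `G`, `𝓔`,
`W`, `Jco`, sizes, numbers; binders `hRdict`/`hudict` on the cube, `hJW`/`hJ`, `hRad`/`hAN`, `hGW`, `hE`/`hB𝓔`, `hSM` —
EXCEPT that the per-section finiteness binder `hfin` is GONE and `hn : 0 < n` (at least one chart coordinate) is
ADDED: a `T`-gauged section of infinite mass has a chart law of infinite mass (`chartLaw_univ_eq`) on which (M1) holds
for free (§1; E2′'s constant is `> 0`), and a finite one is E2′'s own case (A3 on the chart, verbatim).  CONCLUSION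
(unchanged): `SlotAntiConcentration ((fieldMeasure P j SU2).withDensity F) u θ ρ (2(n + β Σ_p L̄_p(d̄_p + 4s̄_p) + B_𝓔)/(1−δ))`.
CONDITIONAL on every binder; nothing PRINTED is asserted. [folklore] -/
theorem slotAC_realized_su2_of_levelData_cube_nofin {T : Finset (PBond P j)} (hT : NoClosedLoop T)
    (U₀ : GaugeField P j SU2) (Λ : Finset (PBond P j)) {n : ℕ} (e : ↥Λ × Fin 3 ≃ Fin n) (hn : 0 < n)
    {S : ℝ} (hS : 0 < S) (hSπ : 3 * S ^ 2 < Real.pi ^ 2) (c : GaugeField P j SU2 → GaugeField P j SU2)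
    {R : GaugeField P j SU2 → (↥Λ → SU2) → ℝ≥0∞} (hR : ∀ V, Measurable (R V))
    {F : GaugeField P j SU2 → ℝ≥0∞} (hF : Measurable F) (hFi : GaugeInvariant F)
    (hFw : ∀ V y, F (fixTo T U₀ (updateFinset V Λ y)) =
      ENNReal.ofReal (expWindowDensity Λ (c V) S (updateFinset (c V) Λ y)) * R V y)
    {u : GaugeField P j SU2 → ℝ} (hu : Measurable u) (hui : GaugeInvariant u)
    -- level data per exterior section
    (Ttr : TraceData A) (hN : 0 < Ttr.N) {ι κ : Type*} {Pu : Finset ι} (hPu : Pu.Nonempty)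
    (hol : GaugeField P j SU2 → ι → (Fin n → ℝ) → A) (hcont : ∀ V, ∀ p ∈ Pu, Continuous (hol V p))
    (Pw : Finset κ) (G : GaugeField P j SU2 → κ → (Fin n → ℝ) → A) (𝓔 : GaugeField P j SU2 → (Fin n → ℝ) → ℝ)
    (W : GaugeField P j SU2 → Set (Fin n → ℝ)) (Jco : GaugeField P j SU2 → (Fin n → ℝ) → ℝ≥0∞)
    {θ δ ρ β Rad H B𝓔 : ℝ} {sw lw dw : κ → ℝ}
    -- DICTIONARY (block weight: on the chart cube only)
    (hRdict : ∀ V, ∀ x ∈ cube n S,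
      R V (expFibreChart Λ (c V) e x) = Jco V x * weight Ttr β Pw (G V) (𝓔 V) x)
    (hudict : ∀ V, ∀ x ∈ cube n S,
      u (fixTo T U₀ (updateFinset V Λ (expFibreChart Λ (c V) e x))) = classifier hPu (hol V) x)
    -- SM-L5/L6: kept co-tests supported in the window, centre-monotone
    (hJW : ∀ V x, Jco V x ≠ 0 → x ∈ W V)
    (hJ : ∀ V x, ∀ a : ℝ, 0 ≤ a → Jco V x ≤ Jco V (Real.exp (-a) • x))
    -- SM-L1 (AN-bound)
    (hRad : 1 < Rad)
    (hAN : ∀ V, ∀ x ∈ W V, ∀ p ∈ Pu, ∃ f : ℂ → A, DifferentiableOn ℂ f (ball 0 Rad) ∧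
      (∀ w ∈ ball (0 : ℂ) Rad, ‖f w‖ ≤ H) ∧ f 0 = 0 ∧ ∀ c' : ℝ, 0 ≤ c' → c' ≤ 1 → f (c' : ℂ) = hol V p (c' • x) - 1)
    -- SM-L3 graded sectioned words
    (hGW : ∀ V, ∀ x ∈ W V, ∀ p ∈ Pw, ∃ gw : List (MLetter A × ℝ × ℝ), (∀ y ∈ gw, y.1.Good Ttr.τ y.2.1 y.2.2) ∧
      sSum gw ≤ sw p ∧ lSum gw ≤ lw p ∧ mdFro (gw.map Prod.fst) ≤ dw p ∧
      ∀ c' : ℝ, 0 ≤ c' → c' ≤ 1 → mwordEval c' (gw.map Prod.fst) = G V p (c' • x))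
    (hsw1 : ∀ p ∈ Pw, sw p ≤ 1) (hsw0 : ∀ p ∈ Pw, 0 ≤ sw p) (hlw0 : ∀ p ∈ Pw, 0 ≤ lw p)
    (hdw0 : ∀ p ∈ Pw, 0 ≤ dw p)
    -- SM-L4 non-Wilson ray bound
    (hE : ∀ V, ∀ x ∈ W V, ∀ c' : ℝ, 1 / 2 ≤ c' → c' ≤ 1 → 𝓔 V (c' • x) ≤ 𝓔 V x + (1 - c') * B𝓔) (hB𝓔 : 0 ≤ B𝓔)
    -- numbers + SM-L2 (SM)
    (hθ : 0 < θ) (hδ0 : 0 ≤ δ) (hδ1 : δ < 1) (hρ0 : 0 ≤ ρ) (hρ : ρ ≤ (1 - δ) / 2) (hβ : 0 ≤ β)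
    (hSM : 36 * H * 1 ^ 2 / (Rad - 1) ^ 2 ≤ δ * θ) :
    SlotAntiConcentration ((fieldMeasure P j SU2).withDensity F) u θ ρ
      (2 * ((n : ℝ) + (β * ∑ p ∈ Pw, lw p * (dw p + 4 * sw p) + B𝓔)) / (1 - δ)) := by
  refine slotAC_realized_su2_of_chartAC_gauge hT U₀ Λ e hS hSπ c hR hF hFi hFw hu hui fun V => ?_
  -- the chart law of the section
  have hsecF : (fun y => F (fixTo T U₀ (updateFinset V Λ y))) =
      fun y => ENNReal.ofReal (expWindowDensity Λ (c V) S (updateFinset (c V) Λ y)) * R V y := funext (hFw V)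
  by_cases hinf : ((blockLaw Λ).withDensity fun y => F (fixTo T U₀ (updateFinset V Λ y))) univ = ∞
  · -- an INFINITE section: the chart law has the same (infinite) mass and E2′'s constant is positive
    have hmass : ((volume : Measure (Fin n → ℝ)).withDensity fun x =>
        (cube n S).indicator (fun x => ENNReal.ofReal (Real.exp (-expJac Λ e x))) x *
          R V (expFibreChart Λ (c V) e x)) univ = ∞ := by
      rw [chartLaw_univ_eq Λ (c V) e hS hSπ (hR V), ← hsecF]
      exact hinf
    have hsum : 0 ≤ ∑ p ∈ Pw, lw p * (dw p + 4 * sw p) := Finset.sum_nonneg fun p hp =>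
      mul_nonneg (hlw0 p hp) (by linarith [hdw0 p hp, hsw0 p hp])
    have hD : 0 < 2 * ((n : ℝ) + (β * ∑ p ∈ Pw, lw p * (dw p + 4 * sw p) + B𝓔)) / (1 - δ) := by
      have hn' : (0 : ℝ) < n := Nat.cast_pos.2 hn
      have hpos : 0 < (n : ℝ) + (β * ∑ p ∈ Pw, lw p * (dw p + 4 * sw p) + B𝓔) := by
        nlinarith [mul_nonneg hβ hsum]
      exact div_pos (by linarith) (by linarith)
    exact slotAntiConcentration_of_measure_univ_eq_top _ hρ0 hD hmass
  · -- a FINITE section: E2′'s chart-level argument verbatim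
    have hdens : (fun x : Fin n → ℝ => (cube n S).indicator (fun x => ENNReal.ofReal (Real.exp (-expJac Λ e x))) x *
          R V (expFibreChart Λ (c V) e x)) =
        fun x => ((cube n S).indicator (fun x => ENNReal.ofReal (Real.exp (-expJac Λ e x))) x * Jco V x) *
          weight Ttr β Pw (G V) (𝓔 V) x := by
      funext x
      by_cases hx : x ∈ cube n S
      · rw [hRdict V x hx, mul_assoc]
      · simp only [indicator_of_notMem hx, zero_mul]
    rw [hdens]
    have hfin' : ((volume : Measure (Fin n → ℝ)).withDensity fun x =>
        ((cube n S).indicator (fun x => ENNReal.ofReal (Real.exp (-expJac Λ e x))) x * Jco V x) *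
          weight Ttr β Pw (G V) (𝓔 V) x) {x | classifier hPu (hol V) x < θ} ≠ ∞ := by
      refine ne_top_of_le_ne_top ?_ (measure_mono (subset_univ _))
      rw [← hdens, chartLaw_univ_eq Λ (c V) e hS hSπ (hR V), ← hsecF]
      exact hinf
    have h := slotAntiConcentration_of_levelData (volume : Measure (Fin n → ℝ)) Ttr hN hPu (hol V) (hcont V) Pw (G V)
      (𝓔 V) (W := W V ∩ cube n S)
      (J := fun x => (cube n S).indicator (fun x => ENNReal.ofReal (Real.exp (-expJac Λ e x))) x * Jco V x)
      (fun x hx => ⟨hJW V x (right_ne_zero_of_mul hx), mem_cube_of_chartWeight_ne_zero (left_ne_zero_of_mul hx)⟩)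
      (fun x a ha => mul_le_mul' (chartWeight_le_smul e hSπ ha x) (hJ V x a ha)) hRad
      (fun x hx p hp => hAN V x hx.1 p hp) (fun x hx p hp => hGW V x hx.1 p hp) hsw1 hsw0 hlw0 hdw0
      (fun x hx c' h1 h2 => hE V x hx.1 c' h1 h2) hB𝓔 hθ hδ0 hδ1 hρ0 hρ hβ hSM hfin'
    simp only [Module.finrank_fintype_fun_eq_card, Fintype.card_fin] at h
    exact slotAntiConcentration_congr_offNull volume (measurableSet_cube' n S)
      (fun x hx => by simp only [indicator_of_notMem hx, zero_mul]) (hudict V) h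

end EndTwoNoFin

end Summit.QuantumFields.BalabanUV.T4Continuum.ShellMeasureRootCompositionNoFinite

end
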